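import Literature.RingTheory.CohomologyAnnihilator.AddTowerGenerator
import Literature.RingTheory.CohomologyAnnihilator.BaseChangeRetract
import Literature.RingTheory.CohomologyAnnihilator.SyzygyBaseChange
import Literature.RingTheory.CohomologyAnnihilator.SyzygyDescent
import Literature.RingTheory.CohomologyAnnihilator.SyzygyBasic
import HarnessLib

/-!
# Descent of a strong generator along a flat, unit-split ring map (Iyengar–Takahashi, proof of Thm. 5.4)

Topic: `Literature/RingTheory/CohomologyAnnihilator`.  The last paragraph of the proof of
[IyengarTakahashi2014, Theorem 5.4] descends the strong generation `Ω^d(mod A_K) ⊆ |G'|ₙ` from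
`A_K = K ⊗ₖ A` (`K = k̄`) to `A` ("we may adapt the argument in [Keller–Van den Bergh,
Prop. 5.1.2]", with the compactness Lemma 4.8).  This file proves the RING-THEORETIC CORE of that
descent, for an arbitrary algebra `A → B` in place of `A → A_K`:

* `exists_isSyzygy_inTower_of_descentData` — let `A`, `B` be noetherian, `B` FLAT over `A`, and
  let `ρ : B → A` be an `A`-linear retraction of the unit (`ρ 1 = 1`).  Suppose `G' ∈ mod B`
  strongly generates, `Ω^d(mod B) ⊆ |G'|ₙ` (in the tree's sense: every finitely generated
  `B`-module has SOME `d`-th syzygy in `|G'|ₙ`), and suppose the restriction `(G' ⊕ B)|_A` lies in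
  `Add G` for a finitely generated `A`-module `G`.  Then `Ω^d(mod A) ⊆ |G|ₙ₊₁`.

  Proof, as in the paper: for `M ∈ mod A` with a `d`-th syzygy `K₀`, the base change `B ⊗_A K₀`
  is a `d`-th syzygy of `B ⊗_A M` (`IsSyzygy.baseChange`, flatness), hence stably isomorphic to
  the given syzygy in `|G'|ₙ` (Schanuel, `IsSyzygy.exists_stablyIso`), hence in `|G' ⊕ B|ₙ₊₁`
  (projective summands lie in `add (G' ⊕ B)`); restricting scalars lands in `|Add G|ₙ₊₁`
  (`inTowerAdd_restrictScalars`), `K₀` is a retract of `(B ⊗_A K₀)|_A`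
  (`exists_retract_restrictScalars_baseChange`, via `ρ`), and Lemma 4.8
  (`inTower_of_retract_inTowerAdd`) gives `K₀ ∈ |G|ₙ₊₁`.

What this leaves for `h_desc` of `singEqVCa_essFiniteType_of_inputs` (`SingEqVCaOfDescent.lean`)
with `B = K ⊗ₖ A`: flatness and the retraction `ρ` (a `k`-basis of `K` through `1`;
cf. `BaseChangeRetract.exists_retraction_tensorProduct` for `A ⊗ₖ K`), `B|_A ∈ Add A` (same
basis), and the generator descent `G'|_A ∈ Add G₀` with `G₀ ∈ mod A` (descent of `G'` to a
finite subextension `l/k`, pieces D1/D4 of the chain).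

## References

* S. B. Iyengar, R. Takahashi, *Annihilation of cohomology and strong generation of module
  categories*, IMRN 2016; arXiv:1404.1476 — proof of Theorem 5.4, Lemma 4.8.
  [`IyengarTakahashi2014`]
* B. Keller, M. Van den Bergh, *Deformed Calabi–Yau completions*, J. reine angew. Math. 654
  (2011), Prop. 5.1.2.
-/

noncomputable section

open CategoryTheory
open scoped TensorProduct

universe u

namespace Literature.RingTheory.CohomologyAnnihilator

variable (A B : Type u) [CommRing A] [CommRing B] [Algebra A B]

/-- A module is a retract of its product with any other module (first factor). [folklore] -/
private theorem exists_retract_prod_fst (X P : ModuleCat.{u} B) :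
    ∃ (i : X ⟶ ModuleCat.of B (X × P)) (p : ModuleCat.of B (X × P) ⟶ X), i ≫ p = 𝟙 X :=
  ⟨ModuleCat.ofHom (LinearMap.inl B X P), ModuleCat.ofHom (LinearMap.fst B X P), by
    ext x; rfl⟩

/-- **Descent of strong generation along a flat, unit-split algebra** (the core of the last step
of the proof of [IyengarTakahashi2014, Thm. 5.4]): with `A`, `B` noetherian, `B` flat over `A`,
`ρ : B → A` an `A`-linear retraction of the unit, `G' ∈ mod B` with `Ω^d(mod B) ⊆ |G'|ₙ`, and
`(G' ⊕ B)|_A ∈ Add G` for a finitely generated `A`-module `G`, one has `Ω^d(mod A) ⊆ |G|ₙ₊₁`: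
every finitely generated `A`-module has a `d`-th syzygy in `|G|ₙ₊₁`.
[cite: IyengarTakahashi2014, Thm. 5.4 (proof)] -/
theorem exists_isSyzygy_inTower_of_descentData [IsNoetherianRing A] [IsNoetherianRing B]
    [Module.Flat A B] (ρ : B →ₗ[A] A) (hρ : ρ 1 = 1) {G' : ModuleCat.{u} B} {d n : ℕ}
    (hgen : ∀ M' : ModuleCat.{u} B, Module.Finite B M' →
      ∃ K'' : ModuleCat.{u} B, IsSyzygy d M' K'' ∧ InTower G' n K'')
    {G : ModuleCat.{u} A} [Module.Finite A G]
    (hG : IsRetractOfCopower G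
      ((restrictScalarsFunctor A B).obj (ModuleCat.of B (G' × B)))) :
    ∀ M : ModuleCat.{u} A, Module.Finite A M →
      ∃ K' : ModuleCat.{u} A, IsSyzygy d M K' ∧ InTower G (n + 1) K' := by
  intro M hM
  haveI := hM
  -- a `d`-th syzygy `K₀` of `M` over `A`, and its base change
  obtain ⟨K₀, hK₀fin, hK₀⟩ := exists_isSyzygy M d
  haveI := hK₀fin
  have hbc : IsSyzygy d (ModuleCat.of B (B ⊗[A] M)) (ModuleCat.of B (B ⊗[A] K₀)) :=
    IsSyzygy.baseChange B d hK₀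
  -- the given syzygy of `B ⊗_A M` in `|G'|ₙ`, and Schanuel
  obtain ⟨K'', hK'', hT⟩ := hgen (ModuleCat.of B (B ⊗[A] M)) inferInstance
  obtain ⟨P₁, P₂, hP₁, hproj₁, hP₂, hproj₂, ⟨e⟩⟩ := IsSyzygy.exists_stablyIso hK'' hbc
  -- everything in `|G' ⊕ B|ₙ₊₁`
  set G'' : ModuleCat.{u} B := ModuleCat.of B (G' × B) with hG''
  have hT'' : InTower G'' (n + 1) K'' :=
    InTower.mono (Nat.le_succ n) (InTower.mono_gen (isRetractOfPower_fst G' (ModuleCat.of B B)) hT)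
  have hP₂add : IsRetractOfPower G'' P₂ :=
    IsRetractOfPower.of_projective (isRetractOfPower_snd G' (ModuleCat.of B B)) hP₂ hproj₂
  have hprod : InTower G'' (n + 1) (ModuleCat.of B (K'' × P₂)) :=
    InTower.prod_of_isRetractOfPower (Nat.succ_le_succ (Nat.zero_le n)) hT'' hP₂add
  have hprod' : InTower G'' (n + 1) (ModuleCat.of B ((B ⊗[A] K₀) × P₁)) := hprod.of_iso e
  obtain ⟨i₁, p₁, hip₁⟩ := exists_retract_prod_fst B (ModuleCat.of B (B ⊗[A] K₀)) P₁
  have hC : InTower G'' (n + 1) (ModuleCat.of B (B ⊗[A] K₀)) := hprod'.of_retract i₁ p₁ hip₁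
  -- restrict scalars, retract to `K₀`, and apply Lemma 4.8
  obtain ⟨i, p, hip⟩ := exists_retract_restrictScalars_baseChange A B ρ hρ K₀
  exact ⟨K₀, hK₀, inTower_of_retract_restrictScalars hG hC i p hip⟩

end Literature.RingTheory.CohomologyAnnihilator

end
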